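import Literature.Probability.Percolation.SlabRSWGluingSegExt
import Literature.Probability.Percolation.SlabRSWGluingHighProbExt
import HarnessLib

/-!
# Newman–Tassion–Wu 2017, §3.2 — GL with a segment target and a top extension: the `B`-near surgery
# from PORT DATA, the located-gadget supply, and Theorem 3.7 in the HIGH-PROBABILITY regime

Topic: `Literature/Probability/Percolation`. Continuation of `SlabRSWGluingSegExt.lean` (the setting
`SegExtSetup`: `S = [a,b] × [c,d] ⊆ R = [a,b] × [c,d']`, `B = {b} × [y₁, y₂]`, `A ⊆ S`, `C ⊆ R`).
Here: (i) p2's `exists_surgeryB_near` (the cleared box meets the segment `B`: trunk from the first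
vertex of `Γ` over the box, through the box minus the column `x = b`, to a vertex `β ∈ B̄`) re-run from
PORT DATA — when `B` lies at least `2ρ + 6` below the top row of `S`, such a box lies inside `S`, so the
body is p2's verbatim with `exists_entry` in place of `exists_port`; (ii) the located-gadget supply at
every entry cell inside `R` (trichotomy: a cell of `A` within `ρ + 3` / the box meets `B` / neither);
(iii) **`glue_highProb_segExt`** — NTW's Theorem 3.7 in the high-probability regime for this geometry,
UNCONDITIONAL, `δ` uniform in the geometry (from the lead's `glue_highProb_of_gadgets_entR`).

## Sources

* C. M. Newman, V. Tassion, W. Wu, *Critical percolation and the minimal spanning tree in slabs*,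
  Comm. Pure Appl. Math. 70 (2017), arXiv:1512.09107: §3.2, Theorem 3.7 and its proof (steps
  (1)–(3), Facts 1–2, `h₁`), pp. 8–10; §3.3, proof of Proposition 3.9, (3.29) [NewmanTassionWu2017].
-/

noncomputable section

namespace Literature.Probability.Percolation

open MeasureTheory LatticeModels SimpleGraph

namespace NTW17

variable {k : ℕ}

/-! ## The `B`-near surgery from port data -/

section AtB

variable {W : SegExtSetup} {ω : BondConfig (slab 3 k)} {ρ : ℕ}

/-- **The `B`-near surgery at a prescribed entry cell, from port data** (segment target `B` at least
`2ρ + 6` below the top row of `S`): given `vnear ∈ R̄` within `ρ` of `Γ̄`, a lattice neighbour `wfar`,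
an `ω`-open self-avoiding path from `c₀ ∈ C̄` to `wfar` inside `R̄` off the `ρ`-neighbourhood of `Γ̄`,
no cell of `A` or `C` within `ρ + 3` of `z = planar vnear`, and the cleared box `(z + B_{rad}) ∩ R`
meeting `B`: a surgery ending in `B̄` whose cleared set is inside `z + B_{ρ+3}`.
[cite: NewmanTassionWu2017, §3.2 (proof of Theorem 3.7, steps (1)–(3), "v = v′ = z"; Fact 2, ω^{(z)})] -/
theorem exists_surgeryB_segExt_at (hk : 1 ≤ k) (hρ : 2 ≤ ρ) (hω : ω ⊆ (slabGraph 3 k).edgeSet)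
    (hX : ω ∈ W.Q.evX k) (hBtop : W.y₂ + 2 * ρ + 6 ≤ W.d)
    {c₀ wfar vnear : slab 3 k} {Lfar : List (slab 3 k)} (hc₀ : c₀ ∈ slabLift k W.C)
    (hLfar : IsOSAP k ω (slabLift k W.R ∩ {x | ¬Near k (W.Q.γ k ω) ρ (planar k x)}) {c₀} {wfar} Lfar)
    (hwv : (slabGraph 3 k).Adj wfar vnear) (hvR : vnear ∈ slabLift k W.R)
    (hnear : Near k (W.Q.γ k ω) ρ (planar k vnear))
    (hnA : ∀ a' ∈ W.A, a' ∉ sqBox (planar k vnear) (ρ + 3))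
    (hnC : ∀ c' ∈ W.C, c' ∉ sqBox (planar k vnear) (ρ + 3))
    (hB : W.Bnear (planar k vnear) (W.rad ρ (planar k vnear))) :
    ∃ sb : W.Q.SurgeryB k ω, sb.D ⊆ sqBox (planar k vnear) (ρ + 3) := by
  have hA : ω ∈ W.Q.evAB k := hX.1
  obtain ⟨hγO, -⟩ := W.Q.γ_spec hA
  set z := planar k vnear with hzdef
  obtain ⟨hR1, hR2⟩ := SegExtSetup.rad_bounds (W := W) ρ z
  set R := W.rad ρ z with hRdef
  set D := W.Dbox z R with hDdef
  set RP := W.DG z R with hRPdef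
  have hzR : z ∈ W.R := hvR
  have hzR' := hzR
  rw [SegExtSetup.mem_R_iff] at hzR'
  have hab := W.hab; have hcd := W.hcd; have hy₁ := W.hy₁; have hy₂ := W.hy₂; have hy := W.hy
  have hdd' := W.hdd'
  -- the centre lies below the row `d` (as `B` meets the box), so `B` meets the box in two rows
  obtain ⟨hBx₀, hBy₀, hBy₀'⟩ := hB
  have hzd : z.2 ≤ W.d := by omega
  have hB2 := SegExtSetup.btwo_of_bnear hzd ⟨hBx₀, hBy₀, hBy₀'⟩
  obtain ⟨hBx, hBy, hBy'⟩ := hB2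
  -- the box lies inside `S`
  have htop : z.2 + R ≤ W.d := by omega
  have hDz : D ⊆ sqBox z (ρ + 3) := (SegExtSetup.Dbox_subset_sqBox _ _).trans (sqBox_mono _ hR2)
  have hRPD : RP ⊆ D := (SegExtSetup.DG_subset_DS _ _).trans (SegExtSetup.DS_subset_Dbox _ _)
  have hzD : z ∈ D := SegExtSetup.mem_Dbox_iff.2 ⟨hzR, mem_sqBox_self _ _⟩
  have hc₀D : planar k c₀ ∉ D := fun h => hnC _ hc₀ (hDz h)
  have hDA : ∀ w ∈ D, w ∉ W.Q.A := fun w hw hwA => hnA w hwA (hDz hw)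
  have hDS : D ⊆ W.S := by
    intro w hw
    rw [SegExtSetup.mem_Dbox_iff, SegExtSetup.mem_R_iff, mem_sqBox_iff'] at hw
    rw [SegExtSetup.mem_S_iff]
    omega
  -- membership criteria
  have memRP : ∀ w : ℤ × ℤ, W.a ≤ w.1 → w.1 ≤ W.b - 1 → z.1 - R ≤ w.1 → w.1 ≤ z.1 + R →
      W.c ≤ w.2 → w.2 ≤ W.d → z.2 - R ≤ w.2 → w.2 ≤ z.2 + R → w ∈ RP := by
    intro w h1 h2 h3 h4 h5 h6 h7 h8
    rw [SegExtSetup.mem_DG_iff, SegExtSetup.mem_S_iff, mem_sqBox_iff']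
    exact ⟨⟨h1, by omega, h5, h6⟩, ⟨h3, h4, h7, h8⟩, by omega⟩
  have memD : ∀ w : ℤ × ℤ, w ∈ D → W.a ≤ w.1 ∧ w.1 ≤ W.b ∧ z.1 - R ≤ w.1 ∧ w.1 ≤ z.1 + R ∧
      W.c ≤ w.2 ∧ w.2 ≤ W.d ∧ z.2 - R ≤ w.2 ∧ w.2 ≤ z.2 + R := by
    intro w hw
    have hwS := hDS hw
    rw [SegExtSetup.mem_Dbox_iff, SegExtSetup.mem_R_iff, mem_sqBox_iff'] at hw
    rw [SegExtSetup.mem_S_iff] at hwS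
    omega
  -- the port: the first entry of the far path into `D̄` (its last vertex `wfar` lies over `D`)
  have hwL : wfar ∈ Lfar := by
    have := hLfar.last_mem hLfar.ne_nil
    rw [Set.mem_singleton_iff] at this
    rw [← this]; exact List.getLast_mem _
  have hwfarD : planar k wfar ∈ D := by
    refine SegExtSetup.mem_Dbox_iff.2 ⟨(hLfar.subset wfar hwL).1, sqBox_mono _ (by omega : 1 ≤ R) ?_⟩
    exact planar_mem_sqBox_one_of_adj hwv.symm
  have hheadL : Lfar.head hLfar.ne_nil = c₀ := by
    have := hLfar.head_mem hLfar.ne_nil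
    rwa [Set.mem_singleton_iff] at this
  have hheadD : planar k (Lfar.head hLfar.ne_nil) ∉ D := by rw [hheadL]; exact hc₀D
  obtain ⟨mfar, w', restfar, hmfar, hLeqfar, hmfarD, hw'D, hedgefar, -, -, hconnfar, -⟩ :=
    exists_entry (R := W.R) hLfar.chain hLfar.nodup (fun x hx => (hLfar.subset x hx).1) hLfar.ne_nil
      hheadD ⟨wfar, hwL, hwfarD⟩
  rw [hheadL] at hconnfar
  set q₁ := mfar.getLast hmfar with hq₁def
  have hadj : (slabGraph 3 k).Adj w' q₁ := ((SimpleGraph.mem_edgeSet _).1 (hω hedgefar)).symm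
  have hq₁D : planar k q₁ ∉ D := hmfarD _ (List.getLast_mem hmfar)
  have hσ : ω ∈ openConnIn (slabLift k (W.Q.R \ D)) q₁ c₀ := openConnIn_reverse hconnfar
  have hw'far : ¬Near k (W.Q.γ k ω) ρ (planar k w') := (hLfar.subset w' (by rw [hLeqfar]; simp)).2
  -- a vertex of `γ` over `D` other than the last
  obtain ⟨g₀, hg₀, hz⟩ := hnear
  have hg₀z : planar k g₀ ∈ sqBox z ρ := GlueGeom.mem_sqBox_comm hz
  have hg₀h := ne_head_of_far_A (Q := W.Q) hA hz (by omega : ρ ≤ ρ + 3) hnA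
  have hin : ∃ x ∈ W.Q.γ k ω, planar k x ∈ D ∧ x ≠ (W.Q.γ k ω).getLast hγO.ne_nil := by
    by_cases hlast : g₀ = (W.Q.γ k ω).getLast hγO.ne_nil
    · obtain ⟨u, huγ, hadj₀, -, hul⟩ := exists_pred hω hA hg₀ hg₀h
      refine ⟨u, huγ, SegExtSetup.mem_Dbox_iff.2 ⟨W.S_subset_R (hγO.subset u huγ),
        sqBox_mono _ (by omega : ρ + 1 ≤ R) ?_⟩, hul⟩
      exact mem_sqBox_add hg₀z (planar_mem_sqBox_one_of_adj hadj₀.symm)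
    · exact ⟨g₀, hg₀, SegExtSetup.mem_Dbox_iff.2 ⟨W.S_subset_R (hγO.subset g₀ hg₀),
        sqBox_mono _ (by omega) hg₀z⟩, hlast⟩
  -- the decomposition at the first vertex over `D`
  obtain ⟨p₀, E₁, rest, hγeq, hp₀, hrest, hp₀D, hE₁D⟩ := exists_decompB (Q := W.Q) hA hDA hin
  have hE₁γ : E₁ ∈ W.Q.γ k ω := by rw [hγeq]; simp
  have hE₁B : planar k E₁ ∉ W.B := by
    intro hB'
    have hex : ∃ l, IsOSAP k ω (slabLift k W.Q.S) (slabLift k W.Q.A) (slabLift k W.Q.B) l :=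
      (mem_slabConn_iff_exists_isOSAP ω _ _ _).1 hA
    have h := minPath_prefix_getLast_not_mem W.Q.S_finite hex (p := p₀ ++ [E₁]) (s := rest)
      (by rw [show minPath k ω _ _ _ = W.Q.γ k ω from rfl, hγeq]; simp) hrest (by simp)
    simp at h
    exact h hB'
  obtain ⟨ha1, ha2, ha3, ha4, ha5, ha6, ha7, ha8⟩ := memD _ hE₁D
  obtain ⟨hw1, hw2, hw3, hw4, hw5, hw6, hw7, hw8⟩ := memD _ hw'D
  -- the target vertex `β`
  set yw : ℤ := (planar k w').2 with hywdef
  set yU : ℤ := min W.y₂ (z.2 + R) with hyUdef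
  set yL : ℤ := max W.y₁ (z.2 - R) with hyLdef
  set yβ : ℤ := if yw = yU then yL else yU with hyβdef
  have hyβ : W.y₁ ≤ yβ ∧ yβ ≤ W.y₂ ∧ z.2 - R ≤ yβ ∧ yβ ≤ z.2 + R ∧ yβ ≠ yw := by
    rw [hyβdef]; split_ifs with h <;> omega
  obtain ⟨hyβ1, hyβ2, hyβ3, hyβ4, hyβw⟩ := hyβ
  set hβ : ℕ := if ht E₁ = 0 then 1 else 0 with hhβdef
  have hhβk : hβ ≤ k := by rw [hhβdef]; split_ifs <;> omega
  have hhβne : hβ ≠ ht E₁ := by rw [hhβdef]; split_ifs with h <;> omega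
  set β : slab 3 k := vtx k (W.b, yβ) hβ with hβdef
  set β' : slab 3 k := vtx k (W.b - 1, yβ) hβ with hβ'def
  have hβp : planar k β = (W.b, yβ) := planar_vtx _ _
  have hβ'p : planar k β' = (W.b - 1, yβ) := planar_vtx _ _
  have hβB : planar k β ∈ W.B := by rw [hβp, SegExtSetup.mem_B_iff]; exact ⟨rfl, hyβ1, hyβ2⟩
  have hβS : planar k β ∈ W.S := SegExtSetup.B_subset_S hβB
  have hβD : planar k β ∈ D := by
    rw [hβp, SegExtSetup.mem_Dbox_iff, SegExtSetup.mem_R_iff, mem_sqBox_iff']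
    refine ⟨⟨?_, ?_, ?_, ?_⟩, ?_, ?_, ?_, ?_⟩ <;> dsimp only <;> omega
  have hβ'RP : planar k β' ∈ RP := by
    rw [hβ'p]; refine memRP _ ?_ ?_ ?_ ?_ ?_ ?_ ?_ ?_ <;> dsimp only <;> omega
  have hadjβ : (slabGraph 3 k).Adj β' β := by
    refine adj_of_planarAdj (by rw [hβdef, hβ'def, ht_vtx hhβk, ht_vtx hhβk]) ?_
    rw [hβp, hβ'p]
    exact planarAdj_left (by simp) (by simp)
  -- the terminal `E₁'` of the route (one step inward if `E₁` lies over the column `x = b`)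
  set e₁ := planar k E₁ with he₁def
  set E₁' : slab 3 k := if e₁.1 = W.b then vtx k (W.b - 1, e₁.2) (ht E₁) else E₁ with hE₁'def
  have hE₁'ht : ht E₁' = ht E₁ := by
    rw [hE₁'def]; split_ifs
    · exact ht_vtx (ht_le E₁) _
    · rfl
  have hE₁'p : planar k E₁' ∈ sqBox e₁ 1 ∧ planar k E₁' ∈ RP := by
    rw [hE₁'def]; split_ifs with h
    · rw [planar_vtx]
      refine ⟨by rw [mem_sqBox_iff']; dsimp only; omega, ?_⟩
      refine memRP _ ?_ ?_ ?_ ?_ ?_ ?_ ?_ ?_ <;> dsimp only <;> omega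
    · refine ⟨mem_sqBox_self _ _, ?_⟩
      rw [SegExtSetup.mem_DG_iff]
      exact ⟨hγO.subset E₁ hE₁γ, (SegExtSetup.mem_Dbox_iff.1 hE₁D).2, h⟩
  obtain ⟨hE₁'near, hE₁'RP⟩ := hE₁'p
  have hE₁'β' : E₁' ≠ β' := by
    intro h
    have := congrArg ht h
    rw [hE₁'ht, hβ'def, ht_vtx hhβk] at this
    exact hhβne this.symm
  -- the terminal `w''` of the route (one step inward if `w'` lies over the column `x = b`)
  set ew := planar k w' with hewdef
  set w'' : slab 3 k := if ew.1 = W.b then vtx k (W.b - 1, ew.2) (ht w') else w' with hw''def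
  have hw''p : planar k w'' ∈ sqBox ew 1 ∧ planar k w'' ∈ RP ∧ (planar k w'').2 = yw := by
    rw [hw''def]; split_ifs with h
    · rw [planar_vtx]
      refine ⟨by rw [mem_sqBox_iff']; dsimp only; omega, ?_, by simp [hywdef, hewdef]⟩
      refine memRP _ ?_ ?_ ?_ ?_ ?_ ?_ ?_ ?_ <;> dsimp only <;> omega
    · refine ⟨mem_sqBox_self _ _, ?_, rfl⟩
      rw [SegExtSetup.mem_DG_iff]
      exact ⟨hDS hw'D, (SegExtSetup.mem_Dbox_iff.1 hw'D).2, h⟩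
  obtain ⟨hw''near, hw''RP, hw''y⟩ := hw''p
  have hw''E₁' : planar k E₁' ≠ planar k w'' := by
    intro h
    -- then `planar w'` is within `2` of `e₁ ∈ γ̄`, contradicting `¬ Near ρ`
    apply hw'far
    refine Near.mono (by omega : 2 ≤ ρ) ⟨E₁, hE₁γ, ?_⟩
    have h1 : planar k w'' ∈ sqBox e₁ 1 := h ▸ hE₁'near
    have h2 : ew ∈ sqBox (planar k w'') 1 := GlueGeom.mem_sqBox_comm hw''near
    exact mem_sqBox_add h1 h2
  have hw''β' : planar k β' ≠ planar k w'' := by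
    intro h
    have := congrArg Prod.snd h
    rw [hβ'p, hw''y] at this
    exact hyβw (by simpa using this)
  -- the rows of the route box
  have hrows : max W.c (z.2 - (R : ℕ)) + 3 ≤ min W.d (z.2 + (R : ℕ)) := by
    simp only [max_add, le_min_iff, max_le_iff]
    omega
  -- the route in `RP`
  obtain ⟨L, Br, c, spec⟩ := exists_route (xL := max W.a (z.1 - (R : ℕ)))
    (xR' := min (W.b - 1) (z.1 + (R : ℕ))) (xR := min (W.b - 1) (z.1 + (R : ℕ)))
    (rB := max W.c (z.2 - (R : ℕ))) (rP := min W.d (z.2 + (R : ℕ))) (rT := min W.d (z.2 + (R : ℕ)))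
    hk (by omega) le_rfl hrows le_rfl hE₁'RP hβ'RP hw''RP hE₁'β'
    hw''E₁' hw''β'
  have hLRP : ∀ v ∈ L, planar k v ∈ RP := spec.hL_sub
  have hBrRP : ∀ v ∈ Br, planar k v ∈ RP := spec.hBr_sub
  have notRP_b : ∀ w : ℤ × ℤ, w.1 = W.b → w ∉ RP := fun w hw h => (SegExtSetup.mem_DG_iff.1 h).2.2 hw
  have hw'E₁ : w' ≠ E₁ := by
    intro h
    exact hw'far (Near.mono (Nat.zero_le _) ⟨E₁, hE₁γ, by rw [hewdef, h]; exact mem_sqBox_self _ 0⟩)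
  -- step 1: the branch ends at `w'`
  obtain ⟨Br₁, spec₁, hBr₁⟩ : ∃ Br₁, RouteSpec k RP D E₁' β' w' L Br₁ c ∧
      ∀ v ∈ Br₁, planar k v ∈ RP ∨ v = w' := by
    by_cases h : ew.1 = W.b
    · have hw''eq : w'' = vtx k (W.b - 1, ew.2) (ht w') := by rw [hw''def, if_pos h]
      have hadjw : (slabGraph 3 k).Adj w'' w' := by
        refine adj_of_planarAdj (by rw [hw''eq, ht_vtx (ht_le _)]) ?_
        rw [hw''eq, planar_vtx]
        exact planarAdj_left (by dsimp only; rw [← hewdef]; omega) rfl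
      have hw'L : w' ∉ L := fun hm => notRP_b ew h (hLRP _ hm)
      have hw'CB : w' ∉ c :: Br := by
        intro hm
        rcases List.mem_cons.1 hm with hm | hm
        · exact notRP_b ew h (by rw [hewdef, hm]; exact hLRP _ spec.hc)
        · exact notRP_b ew h (hBrRP _ hm)
      refine ⟨Br ++ [w'], RouteSpec.concat_branch spec hRPD hadjw hw'L hw'CB hw'D, fun v hv => ?_⟩
      rcases List.mem_append.1 hv with hv | hv
      · exact Or.inl (hBrRP v hv)
      · exact Or.inr (List.mem_singleton.1 hv)
    · have hw''eq : w'' = w' := by rw [hw''def, if_neg h]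
      refine ⟨Br, ?_, fun v hv => Or.inl (hBrRP v hv)⟩
      rw [← hw''eq]; exact RouteSpec.mono spec subset_rfl hRPD
  -- step 2: the trunk starts at `E₁`
  obtain ⟨L₂, spec₂, hL₂⟩ : ∃ L₂, RouteSpec k D D E₁ β' w' L₂ Br₁ c ∧
      ∀ v ∈ L₂, v ≠ E₁ → planar k v ∈ RP := by
    by_cases h : e₁.1 = W.b
    · have hE₁'eq : E₁' = vtx k (W.b - 1, e₁.2) (ht E₁) := by rw [hE₁'def, if_pos h]
      have hadjE : (slabGraph 3 k).Adj E₁ E₁' := by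
        refine (adj_of_planarAdj (by rw [hE₁'eq, ht_vtx (ht_le _)]) ?_).symm
        rw [hE₁'eq, planar_vtx]
        exact planarAdj_left (by dsimp only; rw [← he₁def]; omega) rfl
      have hE₁L : E₁ ∉ L := fun hm => notRP_b e₁ h (hLRP _ hm)
      have hE₁Br : E₁ ∉ Br₁ := by
        intro hm
        rcases hBr₁ _ hm with h' | h'
        · exact notRP_b e₁ h h'
        · exact hw'E₁ h'.symm
      refine ⟨E₁ :: L, RouteSpec.cons_trunk spec₁ hRPD hadjE hE₁L hE₁Br hE₁D, fun v hv hne => ?_⟩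
      rcases List.mem_cons.1 hv with hv | hv
      · exact absurd hv hne
      · exact hLRP v hv
    · have hE₁'eq : E₁' = E₁ := by rw [hE₁'def, if_neg h]
      refine ⟨L, ?_, fun v hv _ => hLRP v hv⟩
      rw [← hE₁'eq]; exact RouteSpec.mono spec₁ hRPD subset_rfl
  -- step 3: the trunk ends at `β`
  have hβL₂ : β ∉ L₂ := by
    intro hm
    by_cases hβE : β = E₁
    · exact hE₁B (by rw [he₁def, ← hβE]; exact hβB)
    · exact notRP_b _ (by rw [hβp]) (hL₂ β hm hβE)
  have hβBr₁ : β ∉ Br₁ := by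
    intro hm
    rcases hBr₁ _ hm with h' | h'
    · exact notRP_b _ (by rw [hβp]) h'
    · apply hyβw
      have := congrArg (fun v => (planar k v).2) h'
      simp only [hβp] at this
      rw [this]
  have spec₃ : RouteSpec k D D E₁ β w' (L₂ ++ [β]) Br₁ c :=
    RouteSpec.concat_trunk spec₂ subset_rfl hadjβ hβL₂ hβBr₁ hβD
  have hint : ∀ v ∈ L₂ ++ [β], v ≠ E₁ → v ≠ β → planar k v ∈ W.Q.S ∧ planar k v ∉ W.Q.B := by
    intro v hv hvE hvβ
    rcases List.mem_append.1 hv with hv | hv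
    · have hvRP := hL₂ v hv hvE
      exact ⟨(SegExtSetup.mem_DG_iff.1 hvRP).1, SegExtSetup.DG_disjoint_B hvRP⟩
    · exact absurd (List.mem_singleton.1 hv) hvβ
  have hE₁β : E₁ ≠ β := fun h => hE₁B (by rw [he₁def, h]; exact hβB)
  obtain ⟨sb, hsb⟩ := exists_surgeryB_of_decomp (Q := W.Q) (SegExtSetup.Dbox_subset_R _ _) hDA hγeq
    hp₀ hrest hp₀D hE₁D hE₁β hβD hβS hβB hadj hq₁D hc₀ hσ spec₃ hint
  exact ⟨sb, hsb ▸ hDz⟩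

end AtB

/-! ## The located-gadget supply and the high-probability GL -/

section Supply

variable {W : SegExtSetup} {ω : BondConfig (slab 3 k)} {ρ : ℕ}

/-- **A located gadget at every entry cell inside `R`** (segment target `B` at least `2ρ + 6` below the
top row of `S`, `C` at sup-distance `> 2ρ + 3` from `S`, `dist*(A, C) > 4ρ + 8`): for a lattice
configuration of `𝒳_ρ` and `y ∈ U_ent(ω) ∩ R`, one of the three port-data constructors applies — a
direct gluing near `A` if a cell of `A` is within `ρ + 3`, else the `B`-near or the plain surgery
according to whether the cleared box meets `B`.
[cite: NewmanTassionWu2017, §3.2 (proof of Theorem 3.7, Fact 2: "For any z ∈ U(ω) … we will construct ω^{(z)}")] -/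
theorem exists_gadgetAt_segExt (hk : 1 ≤ k) (hρ : 2 ≤ ρ) (hBtop : W.y₂ + 2 * ρ + 6 ≤ W.d)
    (hsep : ∀ a' ∈ W.A, ∀ c' ∈ W.C, c' ∉ sqBox a' (4 * ρ + 8))
    (hfarC : ∀ c' ∈ W.C, ∀ s' ∈ W.S, c' ∉ sqBox s' (2 * ρ + 3))
    (hω : ω ⊆ (slabGraph 3 k).edgeSet) (hX : ω ∈ W.Q.evXn k ρ) {y : ℤ × ℤ} (hy : y ∈ W.Q.UentR k ρ ω) :
    ∃ ω', GadgetAt W.Q k (ρ + 3) ω ω' y := by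
  have hX' : ω ∈ W.Q.evX k := hX.1
  have hA : ω ∈ W.Q.evAB k := hX'.1
  obtain ⟨⟨hnear, u, v, hvy, huv, hufar, c₀, hc₀, hj⟩, hyR⟩ := hy
  subst hvy
  obtain ⟨L, hL⟩ := exists_isOSAP_of_openConnIn hj
  have hvR : v ∈ slabLift k W.R := hyR
  -- no cell of `C` near an entry cell
  have hnC : ∀ c' ∈ W.C, c' ∉ sqBox (planar k v) (ρ + 3) := by
    intro c' hc' hc'v
    obtain ⟨g, hg, hvg⟩ := hnear
    have hgS : planar k g ∈ W.S := (W.Q.γ_spec hA).1.subset g hg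
    have : c' ∈ sqBox (planar k g) (ρ + (ρ + 3)) := mem_sqBox_add hvg hc'v
    exact hfarC c' hc' (planar k g) hgS (by rwa [show 2 * ρ + 3 = ρ + (ρ + 3) by ring])
  by_cases hA' : ∃ a' ∈ W.A, a' ∈ sqBox (planar k v) (ρ + 3)
  · obtain ⟨dg, hdg⟩ := exists_directGlue_A_segExt_at hω hX' hsep hc₀ hL huv hA'
    exact ⟨_, gadgetAt_of_directGlue_A (Q := W.Q) hX' dg hdg⟩
  push Not at hA'
  by_cases hB : W.Bnear (planar k v) (W.rad ρ (planar k v))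
  · obtain ⟨sb, hsb⟩ := exists_surgeryB_segExt_at hk hρ hω hX' hBtop hc₀ hL huv hvR hnear hA' hnC hB
    exact ⟨_, gadgetAt_of_surgeryB (Q := W.Q) hX' sb hsb⟩
  · obtain ⟨sx, hsx⟩ := exists_surgery_segExt_at hk hρ hω hX' hc₀ hL huv hvR hnear hA' hnC hB
    exact ⟨_, gadgetAt_of_surgery (Q := W.Q) hX' sx hsx⟩

/-- **NTW 2017, Theorem 3.7 (`S ⊊ R`), HIGH-PROBABILITY REGIME, segment target with a top extension —
unconditional.** For every `k ≥ 1`, `ρ ≥ 2`, `ε > 0`, `η > 0` there is `δ > 0` such that for every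
`SegExtSetup` `W` (`S = [a,b]×[c,d] ⊆ R = [a,b]×[c,d']`, `B = {b}×[y₁,y₂]` with `y₂ + 2ρ + 6 ≤ d`,
`A ⊆ S`, `C ⊆ R`) with `dist*(A, C) > 4ρ + 8` and `dist*(C, S) > 2ρ + 3`, and every `p ∈ [ε, 1-ε]`:
`P_p[C̄ ⟷^{R̄} 𝒩(Γ̄, ρ)] ≥ 1 - δ ⟹ P_p[C ⟷^R A] ≥ 1 - η` (`Γ = Γ_min^S(A, B)`).
[cite: NewmanTassionWu2017, Theorem 3.7 (high-probability regime: h₁(1) = 1, uniformly)] -/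
theorem glue_highProb_segExt (k ρ : ℕ) (hk : 1 ≤ k) (hρ : 2 ≤ ρ) {ε : ℝ} (hε : 0 < ε) {η : ℝ}
    (hη : 0 < η) :
    ∃ δ : ℝ, 0 < δ ∧ ∀ (W : SegExtSetup), W.y₂ + 2 * ρ + 6 ≤ W.d →
      (∀ a' ∈ W.A, ∀ c' ∈ W.C, c' ∉ sqBox a' (4 * ρ + 8)) →
      (∀ c' ∈ W.C, ∀ s' ∈ W.S, c' ∉ sqBox s' (2 * ρ + 3)) →
      ∀ (p : unitInterval), ε ≤ (p : ℝ) → (p : ℝ) ≤ 1 - ε →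
      1 - δ ≤ (bondPercolation (slabGraph 3 k) p).real (W.Q.evNear k ρ) →
      1 - η ≤ (bondPercolation (slabGraph 3 k) p).real (W.Q.evCA k) := by
  obtain ⟨δ, hδ, H⟩ := glue_highProb_of_gadgets_entR k ρ (ρ + 3) hε hη
  refine ⟨δ, hδ, fun W hBtop hsep hfarC p hpε hp1 hN => H W.Q (fun c' hc' s' hs' h => ?_) p hpε hp1 ?_ hN⟩
  · exact hfarC c' hc' s' hs' (sqBox_mono _ (by omega) h)
  · intro ω hω hX y hy
    exact exists_gadgetAt_segExt hk hρ hBtop hsep hfarC hω hX hy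

end Supply

end NTW17

end Literature.Probability.Percolation

end
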